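import Summits.NavierStokesRegularity.NavierStokesRegularity.Theses.PerpetualPump
import Literature.Analysis.FluidPDE.TaoAveragedSobolevProofs
import Literature.Analysis.FluidPDE.TaoMildSolutionBounds
import Literature.Analysis.FluidPDE.TaoAveragedSobolevSymmetry
import Literature.Analysis.FluidPDE.TaoAveragedSlotFourier
import Literature.Analysis.FluidPDE.TaoAveragedComplexAverageReal
import Literature.Analysis.FluidPDE.TaoAveragedConjugation
import Literature.Analysis.FluidPDE.TaoCascadeProjection
import Literature.Analysis.FluidPDE.TaoAveragedRealParts
import Literature.Analysis.FluidPDE.TaoBandHeatGroup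
import Literature.Analysis.FluidPDE.TaoCascadeDuhamel
import Literature.Analysis.FluidPDE.TaoCascadeWaveletData
import Literature.Analysis.FluidPDE.TaoAveragedCascadeAssembly
import Literature.Analysis.FluidPDE.NSViscosityRescaling

/-!
# Disproof of `AveragedTypeIBlowup` — findings (cdisprove seats, cycles 1–2, v3, 2026-08-16)

Crux `stmt-NavierStokesRegularity-1835` = `PerpetualPump.AveragedTypeIBlowup`: there exist a
symmetric averaging datum `𝒜` with cancellation (Tao 2016 (1.12)–(1.16), honest `L²/H¹⁰_df`
class `Literature.Analysis.FluidPDE.Tao2016.AveragingDatum`), a Schwartz divergence-free `u₀`,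
`T > 0` and an `H¹⁰_df`-mild solution `u` on `[0,T)` at the Type-I rate
`‖u(t)‖_∞ ≤ M (T-t)^{-1/2}` admitting NO mild extension past `T`.

FINDINGS (every theorem in this file is sorry-free unless its docstring says NEAR-MISS):

1. `crux_iff_not_thesis` — the crux is LITERALLY `¬ Thesis` (route target, rank 0), by classical
   logic. Disproving the crux = proving the route's target; the card itself predicts the target
   is FALSE.
2. WHY IT RESISTS (kernel-checked reduction) — `nsMildTypeIExclusion_of_not_crux`: Tao's class
   contains the Navier–Stokes bilinear operator `B` itself (`AveragingDatum.euler`, accepted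
   `euler_form`, `euler_isSymmetric`, `euler_hasCancellation`). Hence `¬ crux` PROVES forward
   Type-I exclusion for the true 3-D Navier–Stokes equations (`ν = 1`, Tao's (1.5)) in the
   `H¹⁰_df`-mild class from Schwartz data (`NSMildTypeIExclusion`, unfolded in
   `nsMildTypeIExclusion_iff`) — an OPEN problem: the KNSS Liouville-conjecture tier
   (in tree `Literature.Analysis.FluidPDE.LiouvilleConjectureNS`, `@[conjecture]`, "Open; it would
   exclude Type I blow-up"); Cheskidov–Dai–Palasek 2025 §1.3 (barrier `InstantaneousTypeIBlowup`
   docstring): finite-time Type-I blow-up for `d ≥ 3` "is a major open question"; proved only under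
   axisymmetry (KNSS 2009, Seregin–Šverák 2009; barrier `AxisymmetricTypeIExclusion`), by
   FINE-STRUCTURE tools (vorticity equation, maximum principle for `r u_θ`, backward uniqueness)
   that have no analogue for a non-local averaged `B̃`. With the route's own glue item
   `EulerTypeIGlue` (stmt-1838) the reduction reaches the classical statement "no Type-I blow-up
   for finite-energy classical NS solutions from rapidly decaying data" (`noTypeIClay_of_not_crux`).
   So NO argument available to this seat can disprove the crux; only a formalisation loophole
   could, and the audit (item 4) finds none. Conversely `crux_of_nsTypeIBlowup`: a Type-I blow-up
   of NS itself proves the crux outright (the crux is sandwiched: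
   NS-Type-I-blow-up ⇒ crux ⇔ ¬Thesis).
3. `extension_H10_bounded` / `no_extension_of_H10_unbounded` — the non-extension conjunct in the
   form a prover will discharge it: any mild extension is `H¹⁰`-continuous AT `T`, so
   `sup_{t<T} ‖u(t)‖_{H¹⁰} = ∞` forbids every extension (no uniqueness theory needed). The converse
   (bounded in `H¹⁰` up to `T` ⇒ extends) needs Tao's local `H¹⁰` well-posedness for averaged
   equations (his remark after (1.15)) and is not in the tree; it is the only place where a
   DISproof would need PDE input beyond logic, and it is not the hard part.
4. JUNK / DEGENERACY AUDIT (no kill): (a) `AveragingDatum` is inhabited by non-junk data (`euler`;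
   Tao's cascade datum, `localCascade_isAveraged_holds`), `IsSymmetric ∧ HasCancellation` is
   satisfiable (`exists_isSymmetric_and_hasCancellation`); (b) `IsMildSolution` is honest: values in
   `H¹⁰_df`, `H¹⁰`-continuity on `Ico 0 T`, Duhamel identity in `(H¹⁰_df)*`; the Bochner time
   integral carries no exploitable junk because continuity is imposed and all arguments stay in
   `H¹⁰_df` (`[0,t] ⊆ Ico 0 T`); (c) the Type-I conjunct only bites as `t ↑ T` (on `[0,T-δ]` an
   `H¹⁰`-continuous curve is bounded in `H¹⁰ ⊂ L^∞`); `M ≤ 0` forces `u ≡ 0`, hence (mild initial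
   condition against `w = u₀ ∈ H¹⁰_df`) `u₀ = 0`, and then `v ≡ 0` extends (`isMildSolution_zero`):
   degenerate constants are excluded, nothing more; (d) the extension clause quantifies `v` on
   `Ico 0 T'` with the SAME datum and agreement on `Ico 0 T` — exactly "u continues as a mild
   solution", no loophole (e.g. `v` cannot restart from other data).
4b. HYPOTHESIS MUTATION — `IsSymmetric` IS REDUNDANT (kernel-checked, §4b below;
   `averagedTypeIBlowup_iff_noSymm`, `thesis_noSymm`): the equation only sees the quadratic form
   `u ↦ B̃(u,u)`; the accepted symmetrisation `𝒜.symmetrize` has the same quadratic form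
   (`symmetrize_form_diag`, unconditional), hence the SAME mild solutions
   (`isMildSolution_symmetrize_iff`), is symmetric and keeps (1.16). So the crux ⇔ the crux over
   ALL data with cancellation, and `Thesis` ⇔ Type-I exclusion for all data with cancellation.
   Dropping `HasCancellation` instead is NOT innocuous (item 5). Dropping `IsDivFree u₀`: the mild
   initial condition is an identity in `(H¹⁰_df)*`, so only the Leray projection of `u₀` is seen —
   a non-solenoidal `u₀` changes nothing but bookkeeping (not formalised: needs the projection).
5. NATURAL VARIANTS (information for provers; prose, the PDE theory needed is not in the tree):
   * rate conjunct DROPPED (`AveragedBlowupNoRate` below): this is Theorem 1.5 in local form —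
     TRUE in print and, in its global-nonexistence face, PROVED in tree
     (`Tao2016.averagedNS_blowup_holds`); Tao's witness is Type II (barrier `TaoAveragedBlowup`;
     dyadic shadow `TruncatedDyadicBlowup.critical_blowup`). So the Type-I conjunct is the whole
     content of the crux.
   * rate STRENGTHENED to subcritical `(T-t)^{-β}`, `β < 1/2` (`AveragedSubcriticalBlowup`):
     expected FALSE class-wide, by an argument INSIDE the abstract class (a priori level; the
     rigorous version needs Tao's local `H¹⁰` theory): the `H^k` energy inequality for
     `∂ₜu = Δu + B̃(u,u)` closes WITHOUT the NS top-order cancellation `⟨(u·∇)∇ᵏu, ∇ᵏu⟩ = 0` —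
     `|⟨B̃(u,u), (-Δ)ᵏu⟩| ≲ 𝔼 ‖A₁u‖_{Lᵖ} ‖A₂u‖_{Ẇ^{k,q}} ‖A₃u‖_{Ḣ^{k+1}}`, `1/p + 1/q = 1/2`, order-0
     multipliers/rotations/dilations bounded on `Lᵖ`, `Ẇ^{k,q}` for `1 < p, q < ∞` with the moment
     bounds, `Ẇ^{k,q} ⊃ Ḣ^{k+3/p}`, Young ⇒ `d/dt ‖u‖²_{Ḣᵏ} ≤ C ‖u‖_{Lᵖ}^{r} ‖u‖²_{Ḣᵏ}` with
     `2/r + 3/p = 1`: the Serrin continuation criterion `u ∈ Lʳ_t Lᵖ_x`, `p < ∞`, is ABSTRACT.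
     With the energy bound (cancellation) `‖u‖_p ≤ ‖u₀‖₂^{2/p} ‖u‖_∞^{1-2/p} ≲ (T-t)^{-β(1-2/p)}`,
     integrable to the power `r` iff `β < (1-3/p)/(2(1-2/p)) ↑ 1/2` (`p → ∞`). So every `β < 1/2`
     is excluded abstractly, while `β = 1/2` escapes EVERY `p < ∞` and `p = ∞` is exactly where
     order-0 multipliers are unbounded (Tao's p. 7 footnote): the Type-I tier of the crux is the
     FIRST tier not reachable by the abstract energy method — consistent with the card, and a
     reason no cheap disproof exists. Not formalised (no `H^k` energy calculus for `B̃` in tree).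
   * `HasCancellation` DROPPED: finite-time blow-up becomes cheap in print for NS-like equations
     without the energy identity (Montgomery-Smith 2001, barrier `CheapNavierStokesBlowup`), but
     that witness is scalar/not of the form `B̃`, and its rate is not Type I; no in-class statement
     is claimed here.
   * exogenous clock ALLOWED (time-dependent `B̃(t)`): a Type-I-rate, exactly DSS witness EXISTS at
     the ODE level (barrier facet `TruncatedDyadicTypeIBlowup`, `TruncatedDyadic.Tao2016_prop51_dss`,
     kernel-checked). Autonomy is therefore the only structural feature a disproof could use
     beyond the abstract class — and autonomy alone is not known to exclude Type I even for NS.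
6. LITERATURE (searched 2026-08-16: zbMATH via `lit search --source zbmath` — OpenAlex/S2/arXiv
   APIs 429, searchd rc 75 this session; galaxy bm25 `--star pdf` 20 rows, none relevant; texts
   read: Tao 2016 pp. 5, 7, 8; Albritton–Barker 2019 §1, Rem. 3.2; Plecháč–Šverák 2003 §1):
   * `ledger negatives --problem NavierStokesRegularity` (1 entry, unrelated) and the barrier
     catalogue contain no refutation of a Type-I EXISTENCE statement in an averaged/model class.
   * Status of the reduction target: "many questions concerning feasible Type I scenarios, e.g.,
     discretely self-similar blow-up, remain completely open" (Albritton–Barker 2019, §1); KNSS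
     conjecture (L) ⇒ no Type I (ibid.; in tree `LiouvilleConjectureNS`). Albritton–Barker Thm 1.1:
     for NS, a suitable weak solution with a Type-I singular point EXISTS iff a non-trivial mild
     bounded ancient solution with Type-I decay exists ("constructing ancient solutions with Type I
     decay is a (difficult) route to obtaining Navier–Stokes singularities") — the exact NS
     analogue of the route's CircuitPump (ancient DSS pump) → AveragedTypeIBlowup transfer; their
     reverse direction is a BLOW-DOWN (zoom out + Rusin–Šverák persistence of singularities via
     ε-regularity), an alternative to Tao-§6-style stability for PumpTransfer worth recording for
     the planner (ε-regularity/partial regularity IS abstract for amenable averaged operators,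
     Coiculescu 2023). Their Rem. 3.2: the `L^∞` formulation `sup √(-t)‖v‖_∞ < ∞` (the crux's) is
     the one NOT covered by their equivalence ("does not appear to guarantee I < ∞") — another
     sign that the sup-rate tier is the least structured one.
   * Nearest printed Type-I-rate singularities for NS-like systems WITH energy identity and NS
     scaling: Plecháč–Šverák 2003 (arXiv:math/0302129), model `uₜ + a u·∇u + ½(1-a)∇|u|² +
     ½(div u)u = Δu + κ∇div u` — radial (NOT solenoidal, not of the form `B̃`) solutions: NO
     blow-up for `n ≤ 4` under mild decay of the data, numerical self-similar blow-up only for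
     `n > 4`; Tao 2016 Prop. 5.1 at the endpoint (exogenous clock, ODE). So even in far more
     permissive classes no 3-D Type-I-rate singularity with energy identity is in print: the crux,
     if true, is new; if false, its negation contains an open problem. Nothing in print decides it.

   * Cycle 2 (2026-08-16, gen-2 seat): searchd rc 75 again, arXiv API 429, galaxy substring
     swamped by "Reynolds-averaged"; zbMATH keyword API up — "averaged Navier–Stokes blowup" (6 rows:
     Tao 2016, Coiculescu 2023, Kiriukhin 2026 arXiv:2603.23293 Fourier–Galerkin, rest noise),
     "blow-up dyadic model Navier–Stokes" (8 rows: Katz–Pavlović 2005, Cheskidov 2008, BMR 2011,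
     BFM 2011 arXiv:0811.1689, CDF survey 2023, Romito 2014 stochastic dyadic, Palasek 2026
     arXiv:2605.13827, Metta 2020), "Type I singularities Navier–Stokes" ≥ 2020 (Lei–Ren–Tian 2025
     arXiv:2501.08976, Chernobay 2020, Barker–Prange 2020), "Liouville ancient Type I" (Albritton–
     Barker 2019 only): nothing on Type-I RATE blow-up or its exclusion for averaged / model classes.
     READ Coiculescu 2023 p. 4: his abstract partial regularity (Thm 1.3) is for AMENABLE operators
     (Def. 1), which REQUIRE the endpoint bilinear bounds `‖PB(u,v)‖_r ≤ K‖u‖_{p₁}(‖v‖_{p₂}+‖∇v‖_{p₂})`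
     "endpoint cases of integrability included" (`p = ∞`) — an `L^∞` structure that general Tao data
     lack (order-0 multipliers unbounded on `L^∞`). Caveat for the route text "CKN partial
     regularity is itself abstract (Coiculescu)": shown for the amenable sub-class, not for all of
     `AveragingDatum`; consistent with the `L^∞` theme of items 5 and 8.

7. MECHANISM SANITY CHECK (scaling bookkeeping of the intended witness; no obstruction found): in
   Tao's circuit normalisation (α = 2/5, coupling `lamⁿ`, dissipation `lam^{4n/5}`) the critical
   (Type-I) amplitude is `|Xₙ| ~ lam^{-n/5}` at the natural time `-t ~ lam^{-4n/5}`, where the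
   nonlinear rate `lamⁿ|Xₙ| = lam^{4n/5}` EQUALS the dissipation rate: dissipation is O(1)-relevant
   at every step (unlike Thm 1.5, where it is negligible). A Type-I DSS cascade ⇔ per-step energy
   ratio exactly `lam^{-2/5}` ⇔ a fixed fraction `1 - lam^{-2/5}` dissipated or stranded per step;
   ratio above critical ⇒ Tao's Type-II runaway, below ⇒ dissipative decay: the witness is a
   THRESHOLD (codimension-one, one unstable direction) object, so its datum must be tuned — which
   an ∃-statement tolerates (one-parameter shooting in the amplitude), but which makes PumpTransfer
   a stable-manifold statement, not a stability statement. Energy: total dissipation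
   `Σₖ lam^{-2k/5}(1 - lam^{-2/5}) E₀ = E₀` finite, `‖u(t)‖₂ ≤ ‖u₀‖₂` — consistent with (1.16);
   `L³`-type norms of the stranded trail diverge like `k^{1/3}` (facet `TruncatedDyadicTypeIBlowup`
   docstring) — consistent with `CriticalNormBlowupNecessity` (ESS tier untouched). For the fine
   scale ratios `lam = (1+ε₀)^{5/2}` forced by Thm 3.2 the per-step loss is `≈ ε₀` and `≈ 1/ε₀`
   steps share each e-fold of scale: a slow–fast near-continuum cascade, far from the abrupt,
   well-separated transfers of Tao §5–6 — the analysis PumpTransfer needs is new, but nothing here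
   is inconsistent. The ODE-level adversary of crux #2 (`Cruxes/CircuitPump/Disproof.lean`, seat
   cdisprove-1834) reaches the matching verdict for the ancient pump: energy identity powerless
   (infinite energy in low modes, non-energy-preserving DSS rescaling), `m = 1` = signed dyadic model
   at α = 2/5 (kit job j008109 on the scalar pump), no abstract ODE Liouville theorem in sight.

8. THE TYPE-I CONSTANT IS NOT AN INVARIANT OF THE CLASS (cycle 2; kernel-checked, §8 below).
   Averaging data form a CONE: `rscale 𝒜 c` multiplies the slot-0 symbol by a real constant `c`
   (Tao §3.2 ¶1 "use m₁(D) to absorb scalar factors"), `rscale_form : form = c • form`, symmetry and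
   (1.16) are preserved (`rscale_isSymmetric`, `rscale_hasCancellation`), and `u ↦ c u` trades
   amplitude for coupling (`isMildSolution_rscale_smul_iff`: `u` mild for `𝒜` from `u₀` iff `c u`
   mild for `c⁻¹ • 𝒜` from `c u₀`). Hence `averagedTypeIBlowup_iff_withRate`: for EVERY `ε > 0`,
   `crux ↔ AveragedTypeIBlowupWithRate ε` (the crux with the constant `M` FIXED to `ε`; in
   particular `averagedTypeIBlowup_iff_unitRate`). Consequences: (i) the apparent strengthening
   "Type-I blow-up with arbitrarily small constant" is EQUIVALENT to the crux, so it is not a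
   refutable strengthening; (ii) no class-wide disproof can use the size of `M` (no
   perturbative-in-`M` argument lifts to the class); (iii) CONTRAST with NS: for the fixed Euler
   datum the constant is bounded below — Leray 1934 §19 (3.9), in tree
   `Literature.Analysis.FluidPDE.leray_blowup_rate_top` (discharged `_holds`): before a blow-up
   time `‖u(t)‖_∞ ≥ c √ν (T-t)^{-1/2}` — a consequence of the `L^∞` LOCAL THEORY (lifespan
   `τ = A ν V⁻²`), which is exactly what fails for general order-0 multipliers (unbounded on `L^∞`,
   Tao p. 7 fn.). So Leray's lower bound on the RATE CONSTANT is one more NS fact that is NOT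
   abstract over Tao's class: abstractly every exponent `β < 1/2` is excluded (item 5) but at
   `β = 1/2` not even the constant is constrained. (The class is also invariant under parabolic
   rescaling — `lam ↦ lam/σ` in all three slots composed with `rscale σ^{5/2}` — so WLOG `T = 1`;
   not formalised: needs `Dil`/heat commutation on `L2C`.)
9. TIERS (cycle 2; kernel-checked, §5): `averagedTypeIBlowup_of_subcritical :
   AveragedSubcriticalBlowup → AveragedTypeIBlowup` (elementary, `M (T-t)^{-β} ≤ M T^{1/2-β}
   (T-t)^{-1/2}` on `[0,T)`; replaces the v2 `True` placeholder; no Sobolev embedding needed since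
   the rate hypothesis is imposed on all of `[0,T)`) and `not_subcritical_of_not_averagedTypeIBlowup`.
   So `¬ crux` proves the whole subcritical tier as well, and the crux sits exactly between
   "subcritical rate (abstractly excludable, item 5)" and "no rate (Thm 1.5, TRUE, in tree)".
10. OBSTRUCTION MAP FOR THE ROUND-1 LINES (cycle 2; prose; read: Ideas/*.md (8 cards),
   SketchIdeator1.lean, SketchR1K2.lean, Lines/ideator3-sketch.lean, NegativeNotesIdeator1.md N1–N6).
   Every card reaches the crux through an ODE-level Type-I object for a chain of Tao circuits plus
   a transfer. Where each can die, from the disprover's side, and the decisive observable: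
   (a) THRESHOLD lines (abrupt-threshold-shooting `ThresholdTypeIChain`; threshold-pinning
   `BoundaryDatum` + `BoundaryBlowupIsTypeI`). `BoundaryDatum` (the set of global amplitudes on a
   ray is open; the least non-global amplitude is attained) is ABSTRACT and unobjectionable:
   global ⇒ `∫₀^∞ ‖∇u‖² ≤ ‖u₀‖²/2` (energy identity from (1.16)) ⇒ `‖u(tⱼ)‖_{Ḣ^{1/2}} → 0` ⇒
   small-data global theory in `Ḣ^{1/2} ∩ H¹⁰` (only `L²`-Sobolev bilinear bounds, Tao p. 7) plus
   continuous dependence on compact time intervals ⇒ open; the boundary `∂G` is closed and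
   flow-invariant. The load-bearing statement is `BoundaryBlowupIsTypeI`, and it needs TWO
   no-return lemmas bracketing the critical amplitude `Y` of the front: (D) below `Y_min` the
   solution enters the small-data regime (fine, abstract), and (R) above `Y_max` it blows up
   ROBUSTLY (an OPEN condition in `H¹⁰`) FROM EVERY STATE REACHABLE ON `∂G` — i.e. uniformly in the
   frozen trail one scale below the front (energy `O(ε₀)`–`O(1)` of the front's, arbitrary phases
   and signs) and in the intra-scale phases. (R) is strictly stronger than Tao's Thm 4.2 / 6.2
   (clean single-scale datum, no trail, amplitude → ∞): a robust blow-up theorem at BOUNDED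
   supercriticality with a live neighbour below. FAILURE MODE (the disprover's bet for where the
   threshold lines die, if they die): backscatter from the trail defuses a supercritical front,
   which then re-arms later — at the bisection threshold the passage amplitudes `Y_n` make
   unbounded EXCURSIONS. Then a boundary blow-up still exists but violates the UNIFORM bound
   `‖u(t)‖_∞ √(T-t) ≤ M` (the crux's rate conjunct is `∀ t ∈ [0,T)`: `limsup = ∞` along a
   subsequence kills the witness, not only the proof) without being robustly Type II either —
   "boundary blow-up of neither tier" is a consistent third outcome that both threshold cards
   silently exclude. Their queued jobs (j008851/j008855, "KILL if Y_n do not plateau") measure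
   exactly this; a plateau with bounded oscillation supports (R), drifting maxima refute it for
   that circuit. (Monotonicity of the outcome in `A` is NOT needed: the shooting principle
   tolerates interleaved die/fire bands; uniform pinning is what is needed.)
   (b) ORBIT lines (route CircuitPump + PumpTransfer; attracting-type-i-cycle;
   viscous-comparator-gated-pump). N1 (uniform damping of the modes of ONE scale is conjugate to
   the inviscid flow run for a finite effective time ⇒ energy FRACTIONS of a single-scale gate are
   amplitude-independent at first order in the viscous fraction μ) makes the Type-I fixed point of
   an amplitude-blind chain REPELLING (multiplier `1 + νt_c/Y* > 1`): a Type-I orbit of Tao's own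
   circuit is a saddle, which still proves the ∃-crux by one-parameter shooting (item 7) but gives
   no open basin. "Attracting" designs must read the INTER-scale damping contrast `λ^{4/5} - 1`
   (`≈ 2ε₀` at the fine ratio forced by Thm 3.2) and amplify it by a gain `G ~ 1/ε₀` into an `O(μ)`
   tilt `dφ_fwd/dμ > 2φ₀` of the forwarded fraction — attracting-type-i-cycle does exactly this
   (two-clock comparator, fuses at adjacent scales), so N1 does NOT kill it; viscous-comparator
   designs reading an intra-scale contrast are killed by N1. Disprover's residual objections to the
   attracting design: (i) the same gain `G` amplifies Lemma 4.1's deterministic `O(ε₀)` damping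
   renormalisations of the wavelets — the card proposes to CALIBRATE them into the comparator,
   legitimate since they are computable constants of the profiles, but then the PDE witness depends
   on profile-specific constants and the ODE statement alone is not the transferable object;
   (ii) an attracting Type-I cycle means STABLE (H¹⁰-open) Type-I blow-up for that averaged
   equation — stronger than the crux, abstractly unobstructed (Tao's Type-II blow-up is itself
   robust), but every known critical-threshold phenomenology (item 7's critical-collapse
   dictionary) has the self-similar solution as a codimension-one saddle, so the design fights the
   generic picture and the decisive number is the sign and size of `dφ_fwd/dμ - 2φ₀` measured in
   the cards' jobs (j009237, j009770 race-of-two-output-stages; control j008852). At coarse ratio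
   (coarse-lattice-thin-wavelets, hop `q ≤ 2`) the inter-scale contrast is `O(1)` and no large
   gain is needed — the natural home of attracting designs if Thm 3.2 indeed decouples hop ratio
   from wavelet thinness (ideator 3's `CoarseCascadeIsAveraged`, unproved).
   (c) EXACT-PROFILE lines (haar-averaged-exact-profile, haar-dilation-selfsimilar). Pairing the
   profile equation `-ΔU + ½U + ½y·∇U = B̄(U,U)` with `U` and using (1.16) gives only the
   automatic identity `‖∇U‖₂² = ¼‖U‖₂²` (the analogue of the first step of Nečas–Růžička–Šverák /
   Tsai; their EXCLUSION needs the local maximum principle for `½|U|² + P + …`, i.e. fine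
   structure) — so nothing cheap excludes averaged Leray profiles; N5 (i)–(v) are the operative
   necessary conditions (Gaussian ray moments must vanish for Schwartz decay; positivity cascades
   cannot give finite energy; exact modulus-locality forces `U ≡ 0`). Caveat for
   haar-dilation-selfsimilar: a Haar average over ALL dilations is not an averaging datum
   (`AveragingDatum.lam_bdd`, finite measure); averaging over one lattice period is, and suffices
   only because the lattice sum is already lattice-covariant (Tao p. 14).
   (d) exact-volterra-embedding / coarse-lattice-thin-wavelets are transfer-side improvements
   (exactness of the §4 reduction; removing the fine-ratio curse); no disproof-side objection —
   they inherit (a) or (b) for the ODE object they transfer.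

11. UNIFORM-DAMPING CONJUGACY (cycle 2; kernel-checked, §11; the content of ideator note N1 and
   of the "fire-or-die is a theorem of the caricature" step of threshold-pinning):
   `hasDerivAt_uniformDamping_conj` — for a continuous bilinear `G` and `D > 0`, if `Y' = G(Y,Y)`
   on the effective-time window `[0,1/D)` then `X(t) = e^{-Dt} Y((1-e^{-Dt})/D)` solves
   `X' = -DX + G(X,X)` for all `t ≥ 0` (`effTime`, `hasDerivAt_effTime`, `effTime_mem_Ico`). So a
   uniformly damped quadratic gate is the inviscid gate run for the finite effective time `1/D`
   with amplitudes scaled by `1 - Dτ`: inviscid events at `τ_c` happen iff `τ_c < 1/D`, delivered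
   energy FRACTIONS are amplitude-blind at first order, the Type-I fixed point of an amplitude-blind
   chain is repelling — the algebraic core of items 7 and 10 (a)–(b). (ODE uniqueness, which
   identifies THE damped solution with this `X`, is not formalised here.)

LANDINGS (negative-side support, `Theorems/AveragedTypeIBlowup/Negative/`, `--supports` 1835):
`NSReduction.lean` (p73518; §§1–3 of this file), `SymmetryRedundant.lean` (p73952; §4b),
`ConstantNormalisation.lean` (cycle 2; §§5-tier, 8; p76891 pending, with the gate-relocated
`Literature.Uncategorized.AveragedSubcriticalBlowup` p76886), `UniformDampingConjugacy.lean`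
(cycle 2; §11; p76906 pending) — import those rather than this work file.

VERDICT (cycle 2): no kill; the crux is an honest open existence statement whose negation is at
least as strong as forward Type-I exclusion for Navier–Stokes; `IsSymmetric` is redundant; the
Type-I constant `M` is free (cone structure — Leray's lower bound on it is non-abstract); the
Type-I tier is exactly the first tier beyond the abstract (Serrin-class) energy method, with the
subcritical tier provably below it; for the round-1 lines the load-bearing new statement is robust
runaway uniformly in the trail (item 10 (a) (R)), whose failure mode — amplitude excursions at
threshold — would kill the witnesses of both threshold cards and is visible in their queued jobs.
-/

noncomputable section

set_option linter.dupNamespace false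

namespace Summit.NavierStokesRegularity.NavierStokesRegularity.Cruxes.AveragedTypeIBlowup.Disproof

open MeasureTheory Set Filter Topology
open scoped ENNReal
open Literature.Analysis.FluidPDE Literature.Analysis.FluidPDE.Tao2016
open Literature.Analysis.FluidPDE.Tao2016.AveragingDatum
open Summit.NavierStokesRegularity.NavierStokesRegularity.Theses.PerpetualPump

/-- Local notation for `ℝ³`. -/
local notation "ℝ³" => EuclideanSpace ℝ (Fin 3)

/-! ## 1. The crux is the negation of the route target -/

/-- `AveragedTypeIBlowup ↔ ¬ Thesis`: the crux is literally the (classical) negation of the route's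
target `Thesis` (abstract Type-I exclusion over Tao's averaging class). [folklore] -/
theorem crux_iff_not_thesis : AveragedTypeIBlowup ↔ ¬ Thesis := by
  unfold AveragedTypeIBlowup Thesis
  constructor
  · rintro ⟨𝒜, hs, hc, u₀, hdiv, T, hT, u, hmild, hrate, hno⟩ h
    exact hno (h 𝒜 hs hc u₀ hdiv T hT u hmild hrate)
  · intro h
    by_contra hcon
    apply h
    intro 𝒜 hs hc u₀ hdiv T hT u hmild hrate
    by_contra hext
    exact hcon ⟨𝒜, hs, hc, u₀, hdiv, T, hT, u, hmild, hrate, hext⟩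

/-- A disproof of the crux is exactly a proof of the route target. [folklore] -/
theorem thesis_of_not_crux (h : ¬ AveragedTypeIBlowup) : Thesis :=
  Classical.not_not.mp (crux_iff_not_thesis.not.mp h)

/-! ## 2. Why it resists: the class contains Navier–Stokes itself -/

/-- **Type-I blow-up for the averaged equation driven by a FIXED datum `𝒜`**: the crux with its
operator quantifier peeled off — a Schwartz divergence-free datum, a time `T > 0` and an
`H¹⁰_df`-mild solution of `∂ₜu = Δu + B̃_𝒜(u,u)` on `[0,T)` at the Type-I rate with no mild
extension past `T`. [cite: Tao2016AveragedNS, (1.15) and §1.1 footnote p. 8] -/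
def TypeIBlowupFor (𝒜 : AveragingDatum) : Prop :=
  ∃ u₀ : SchwartzMap ℝ³ ℝ³, VectorCalculus.IsDivFree ⇑u₀ ∧ ∃ T : ℝ, 0 < T ∧ ∃ u : ℝ → L2C,
    𝒜.IsMildSolution (schwartzL2 u₀) (Ico 0 T) u ∧
    (∃ M : ℝ, ∀ t ∈ Ico 0 T, eLpNorm (u t) ⊤ volume ≤ ENNReal.ofReal (M / Real.sqrt (T - t))) ∧
    ¬ ∃ T' : ℝ, T < T' ∧ ∃ v : ℝ → L2C,
      𝒜.IsMildSolution (schwartzL2 u₀) (Ico 0 T') v ∧ ∀ t ∈ Ico 0 T, v t = u t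

/-- The crux, regrouped: some symmetric datum with cancellation has a Type-I blow-up. [folklore] -/
theorem crux_iff_exists_typeIBlowupFor :
    AveragedTypeIBlowup ↔ ∃ 𝒜 : AveragingDatum, 𝒜.IsSymmetric ∧ 𝒜.HasCancellation ∧ TypeIBlowupFor 𝒜 :=
  Iff.rfl

/-- **Forward Type-I exclusion for the true Navier–Stokes equations in Tao's mild class**
(`ν = 1`, `∂ₜu = Δu + B(u,u)`, Tao 2016 (1.5)): no Schwartz divergence-free datum launches an
`H¹⁰_df`-mild solution that blows up (fails to extend) at the Type-I rate. The Euler datum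
`AveragingDatum.euler` has `B̃ = B` (`euler_form`). This is the `H¹⁰`-mild face of the OPEN
Type-I exclusion problem (KNSS 2009: (L) ⇒ no Type I; in tree `LiouvilleConjectureNS` is a
`@[conjecture]`; Cheskidov–Dai–Palasek 2025 §1.3: "a major open question"). Stated as a `Prop`
only. [cite: KochNadirashviliSereginSverak2009, §1] -/
def NSMildTypeIExclusion : Prop :=
  ¬ TypeIBlowupFor AveragingDatum.euler

/-- **Reduction (why the crux resists disproof).** Any disproof of `AveragedTypeIBlowup` proves
forward Type-I exclusion for Navier–Stokes in Tao's `H¹⁰_df`-mild class, because the Euler datum is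
a symmetric averaging datum with cancellation (`euler_isSymmetric`, `euler_hasCancellation`).
[cite: Tao2016AveragedNS, §1.1 (1.2), (1.13) p. 6] -/
theorem nsMildTypeIExclusion_of_not_crux (h : ¬ AveragedTypeIBlowup) : NSMildTypeIExclusion :=
  fun hb => h ⟨AveragingDatum.euler, euler_isSymmetric, euler_hasCancellation, hb⟩

/-- Conversely, a Type-I blow-up of Navier–Stokes itself (in the mild class) proves the crux
outright: `NS Type-I blow-up ⇒ crux ⇔ ¬Thesis`. [folklore] -/
theorem crux_of_nsTypeIBlowup (hb : TypeIBlowupFor AveragingDatum.euler) : AveragedTypeIBlowup :=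
  ⟨AveragingDatum.euler, euler_isSymmetric, euler_hasCancellation, hb⟩

/-- `NSMildTypeIExclusion` unfolded as the positive continuation statement: every `H¹⁰_df`-mild
Navier–Stokes solution from Schwartz divergence-free data obeying the Type-I rate on `[0,T)`
extends as a mild solution past `T`. [cite: KochNadirashviliSereginSverak2009, §1] -/
theorem nsMildTypeIExclusion_iff :
    NSMildTypeIExclusion ↔
      ∀ u₀ : SchwartzMap ℝ³ ℝ³, VectorCalculus.IsDivFree ⇑u₀ → ∀ T : ℝ, 0 < T → ∀ u : ℝ → L2C,
        AveragingDatum.euler.IsMildSolution (schwartzL2 u₀) (Ico 0 T) u →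
        (∃ M : ℝ, ∀ t ∈ Ico 0 T, eLpNorm (u t) ⊤ volume ≤ ENNReal.ofReal (M / Real.sqrt (T - t))) →
        ∃ T' : ℝ, T < T' ∧ ∃ v : ℝ → L2C,
          AveragingDatum.euler.IsMildSolution (schwartzL2 u₀) (Ico 0 T') v ∧ ∀ t ∈ Ico 0 T, v t = u t := by
  unfold NSMildTypeIExclusion TypeIBlowupFor
  constructor
  · intro h u₀ hdiv T hT u hmild hrate
    by_contra hext
    exact h ⟨u₀, hdiv, T, hT, u, hmild, hrate, hext⟩
  · rintro h ⟨u₀, hdiv, T, hT, u, hmild, hrate, hext⟩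
    exact hext (h u₀ hdiv T hT u hmild hrate)

/-- **Reduction to the classical statement, through the route's own glue item.** Granting
`EulerTypeIGlue` (stmt-NavierStokesRegularity-1838: solution-concept bookkeeping classical ↔
`H¹⁰_df`-mild, `ν`-scaling), a disproof of the crux proves: every finite-energy classical
Navier–Stokes solution on `[0,T)` from a rapidly decaying datum that blows up at the Type-I rate
(`IsTypeIBlowup`) extends smoothly past `T` — i.e. "no Type-I blow-up from Clay data", the open
KNSS/Seregin–Šverák-tier statement. [cite: KochNadirashviliSereginSverak2009, §1] -/
theorem noTypeIClay_of_not_crux (hG : EulerTypeIGlue) (h : ¬ AveragedTypeIBlowup) :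
    ∀ (ν T : ℝ), 0 < ν → 0 < T → ∀ (u : ℝ → ℝ³ → ℝ³) (p : ℝ → ℝ³ → ℝ),
      IsClassicalNSSolutionOn (Ico 0 T) ν 0 u p → IsLerayHopfOn T ν 0 (u 0) u →
      HasRapidSpatialDecay (u 0) → IsTypeIBlowup u T → HasSmoothExtensionPast ν 0 u T :=
  hG (thesis_of_not_crux h)

/-! ## 3. The non-extension conjunct: what it takes -/

/-- **A mild extension past `T` forces `H¹⁰`-boundedness up to `T`.** If `v` is a mild solution on
`[0,T')`, `T < T'`, agreeing with `u` on `[0,T)`, then `‖u(t)‖_{H¹⁰}` is bounded on `[0,T)`: the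
real function `t ↦ ‖v(t)‖_{H¹⁰}` is continuous on `Ico 0 T'` (`ContinuousInH10On.continuousOn_toReal`)
hence bounded on the compact `[0,T] ⊆ Ico 0 T'`. No uniqueness of mild solutions is used. [folklore] -/
theorem extension_H10_bounded {𝒜 : AveragingDatum} {a : L2C} {T T' : ℝ} (hTT' : T < T')
    {u v : ℝ → L2C} (hv : 𝒜.IsMildSolution a (Ico 0 T') v) (huv : ∀ t ∈ Ico 0 T, v t = u t) :
    ∃ C : ℝ, ∀ t ∈ Ico 0 T,
      Literature.Analysis.FunctionSpaces.eFourierSobolevNorm 10 (u t) ≤ ENNReal.ofReal C := by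
  have hv' : IsMildSolutionFor 𝒜.form a (Ico 0 T') v := hv
  have hfin : ∀ t ∈ Ico 0 T',
      Literature.Analysis.FunctionSpaces.eFourierSobolevNorm 10 (v t) < ∞ :=
    fun t ht => (hv'.1 t ht).1
  have hcont := hv'.2.1.continuousOn_toReal hfin
  have hsub : Icc 0 T ⊆ Ico 0 T' := fun t ht => ⟨ht.1, ht.2.trans_lt hTT'⟩
  obtain ⟨C, hC⟩ := isCompact_Icc.exists_bound_of_continuousOn (hcont.mono hsub)
  refine ⟨C, fun t ht => ?_⟩
  have htI : t ∈ Icc 0 T := ⟨ht.1, ht.2.le⟩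
  have h := hC t htI
  rw [Real.norm_eq_abs, abs_le] at h
  rw [← huv t ht, ← ENNReal.ofReal_toReal (hfin t (hsub htI)).ne]
  exact ENNReal.ofReal_le_ofReal h.2

/-- **Prover's form of the non-extension conjunct.** If the `H¹⁰` norm of `u` is unbounded on
`[0,T)` then `u` has no mild extension past `T` (for any datum class `a`, any averaging datum).
This is how `¬ ∃ T' > T, ∃ v, …` in the crux will be discharged: exhibit `‖u(tₖ)‖_{H¹⁰} → ∞`. [folklore] -/
theorem no_extension_of_H10_unbounded {𝒜 : AveragingDatum} {a : L2C} {T : ℝ} {u : ℝ → L2C}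
    (hunb : ∀ C : ℝ, ∃ t ∈ Ico 0 T,
      ENNReal.ofReal C < Literature.Analysis.FunctionSpaces.eFourierSobolevNorm 10 (u t)) :
    ¬ ∃ T' : ℝ, T < T' ∧ ∃ v : ℝ → L2C, 𝒜.IsMildSolution a (Ico 0 T') v ∧ ∀ t ∈ Ico 0 T, v t = u t := by
  rintro ⟨T', hTT', v, hv, huv⟩
  obtain ⟨C, hC⟩ := extension_H10_bounded hTT' hv huv
  obtain ⟨t, ht, hlt⟩ := hunb C
  exact absurd (hC t ht) (not_le.mpr hlt)

/-- The same two facts specialised to the crux's shape: inside any witness of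
`AveragedTypeIBlowup`, NON-extension is implied by (and, modulo Tao's local `H¹⁰` theory for
averaged equations — not in tree — equivalent to) `H¹⁰`-blow-up at `T`; so a witness is exactly an
averaged mild solution with `‖u(t)‖_∞ ≤ M(T-t)^{-1/2}` and `limsup_{t↑T} ‖u(t)‖_{H¹⁰} = ∞`. [folklore] -/
theorem crux_of_H10_blowup_witness (𝒜 : AveragingDatum) (hs : 𝒜.IsSymmetric) (hc : 𝒜.HasCancellation)
    (u₀ : SchwartzMap ℝ³ ℝ³) (hdiv : VectorCalculus.IsDivFree ⇑u₀) (T : ℝ) (hT : 0 < T) (u : ℝ → L2C)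
    (hmild : 𝒜.IsMildSolution (schwartzL2 u₀) (Ico 0 T) u)
    (hrate : ∃ M : ℝ, ∀ t ∈ Ico 0 T, eLpNorm (u t) ⊤ volume ≤ ENNReal.ofReal (M / Real.sqrt (T - t)))
    (hunb : ∀ C : ℝ, ∃ t ∈ Ico 0 T,
      ENNReal.ofReal C < Literature.Analysis.FunctionSpaces.eFourierSobolevNorm 10 (u t)) :
    AveragedTypeIBlowup :=
  ⟨𝒜, hs, hc, u₀, hdiv, T, hT, u, hmild, hrate, no_extension_of_H10_unbounded hunb⟩

/-! ## 4b. Hypothesis mutation: the symmetry conjunct is redundant -/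

/-- **On the partial diagonal the symmetrisation changes nothing**:
`⟨B̃ˢʸᵐ(u,u), w⟩ = ⟨B̃(u,u), w⟩` for ALL `u, w ∈ L²` (unconditionally, no integrability needed:
on heads the integrand is `⟨B(A₂u, A₁u), A₃w⟩ = ⟨B(A₁u, A₂u), A₃w⟩` pointwise in `θ`, by the
symmetry of the Euler form `eulerForm_symm`). [folklore] -/
theorem symmetrize_form_diag (𝒜 : AveragingDatum) (u w : L2C) :
    𝒜.symmetrize.form u u w = 𝒜.form u u w := by
  have key : ∀ p : 𝒜.Ω × Bool,
      eulerForm (𝒜.symmetrize.slot 0 p u) (𝒜.symmetrize.slot 1 p u) (𝒜.symmetrize.slot 2 p w) =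
      eulerForm (𝒜.slot 0 p.1 u) (𝒜.slot 1 p.1 u) (𝒜.slot 2 p.1 w) := by
    rintro ⟨θ, b⟩
    cases b
    · rfl
    · simp only [symmetrize_slot, swapSlot_true_zero, swapSlot_true_one, swapSlot_true_two]
      exact eulerForm_symm _ _ _
  have h : ∫ p, eulerForm (𝒜.symmetrize.slot 0 p u) (𝒜.symmetrize.slot 1 p u)
      (𝒜.symmetrize.slot 2 p w) ∂𝒜.coinMeasure =
      ∫ p, eulerForm (𝒜.slot 0 p.1 u) (𝒜.slot 1 p.1 u) (𝒜.slot 2 p.1 w) ∂𝒜.coinMeasure :=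
    integral_congr_ae (Eventually.of_forall key)
  exact h.trans (𝒜.integral_coinMeasure_comp_fst
    fun θ => eulerForm (𝒜.slot 0 θ u) (𝒜.slot 1 θ u) (𝒜.slot 2 θ w))

/-- **The averaged equation only sees the quadratic form**: `u` is a mild solution for the
symmetrised datum iff it is one for `𝒜` (the Duhamel identity (1.15) involves `⟨B̃(u(s),u(s)), ·⟩`
only). [folklore] -/
theorem isMildSolution_symmetrize_iff (𝒜 : AveragingDatum) (a : L2C) (I : Set ℝ) (u : ℝ → L2C) :
    𝒜.symmetrize.IsMildSolution a I u ↔ 𝒜.IsMildSolution a I u := by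
  unfold AveragingDatum.IsMildSolution IsMildSolutionFor
  simp only [symmetrize_form_diag]

/-- The crux WITHOUT the symmetry conjunct. [folklore] -/
def AveragedTypeIBlowupNoSymm : Prop :=
  ∃ 𝒜 : AveragingDatum, 𝒜.HasCancellation ∧
    ∃ u₀ : SchwartzMap (EuclideanSpace ℝ (Fin 3)) (EuclideanSpace ℝ (Fin 3)),
      VectorCalculus.IsDivFree ⇑u₀ ∧ ∃ T : ℝ, 0 < T ∧ ∃ u : ℝ → L2C,
      𝒜.IsMildSolution (schwartzL2 u₀) (Ico 0 T) u ∧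
      (∃ M : ℝ, ∀ t ∈ Ico 0 T, eLpNorm (u t) ⊤ volume ≤ ENNReal.ofReal (M / Real.sqrt (T - t))) ∧
      ¬ ∃ T' : ℝ, T < T' ∧ ∃ v : ℝ → L2C,
        𝒜.IsMildSolution (schwartzL2 u₀) (Ico 0 T') v ∧ ∀ t ∈ Ico 0 T, v t = u t

/-- **`IsSymmetric` is logically redundant in the crux**: a Type-I blow-up for ANY averaging
datum with cancellation yields one for a SYMMETRIC datum with cancellation — its symmetrisation,
which has the same mild solutions (`isMildSolution_symmetrize_iff`), is symmetric
(`symmetrize_isSymmetric`) and keeps (1.16) (`symmetrize_hasCancellation_iff`). [folklore] -/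
theorem averagedTypeIBlowup_iff_noSymm : AveragedTypeIBlowup ↔ AveragedTypeIBlowupNoSymm := by
  constructor
  · rintro ⟨𝒜, -, hc, u₀, hdiv, T, hT, u, hmild, hrate, hno⟩
    exact ⟨𝒜, hc, u₀, hdiv, T, hT, u, hmild, hrate, hno⟩
  · rintro ⟨𝒜, hc, u₀, hdiv, T, hT, u, hmild, hrate, hno⟩
    refine ⟨𝒜.symmetrize, 𝒜.symmetrize_isSymmetric, 𝒜.symmetrize_hasCancellation_iff.mpr hc,
      u₀, hdiv, T, hT, u, (isMildSolution_symmetrize_iff 𝒜 _ _ _).mpr hmild, hrate, ?_⟩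
    rintro ⟨T', hTT', v, hv, hvu⟩
    exact hno ⟨T', hTT', v, (isMildSolution_symmetrize_iff 𝒜 _ _ _).mp hv, hvu⟩

/-- Dually, the route target `Thesis` (abstract Type-I exclusion for symmetric data with
cancellation) already implies Type-I exclusion for ALL data with cancellation. [folklore] -/
theorem thesis_noSymm (h : Thesis) (𝒜 : AveragingDatum) (hc : 𝒜.HasCancellation)
    (u₀ : SchwartzMap (EuclideanSpace ℝ (Fin 3)) (EuclideanSpace ℝ (Fin 3)))
    (hdiv : VectorCalculus.IsDivFree ⇑u₀) (T : ℝ) (hT : 0 < T) (u : ℝ → L2C)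
    (hmild : 𝒜.IsMildSolution (schwartzL2 u₀) (Ico 0 T) u)
    (hrate : ∃ M : ℝ, ∀ t ∈ Ico 0 T, eLpNorm (u t) ⊤ volume ≤ ENNReal.ofReal (M / Real.sqrt (T - t))) :
    ∃ T' : ℝ, T < T' ∧ ∃ v : ℝ → L2C,
      𝒜.IsMildSolution (schwartzL2 u₀) (Ico 0 T') v ∧ ∀ t ∈ Ico 0 T, v t = u t := by
  obtain ⟨T', hTT', v, hv, hvu⟩ := h 𝒜.symmetrize 𝒜.symmetrize_isSymmetric
    (𝒜.symmetrize_hasCancellation_iff.mpr hc) u₀ hdiv T hT u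
    ((isMildSolution_symmetrize_iff 𝒜 _ _ _).mpr hmild) hrate
  exact ⟨T', hTT', v, (isMildSolution_symmetrize_iff 𝒜 _ _ _).mp hv, hvu⟩

/-! ## 5. Natural variants (definitions only; see the module docstring for their status) -/

/-- The crux WITHOUT the Type-I rate conjunct: a finite-time non-extendable mild solution for some
symmetric averaged operator with cancellation. This is Tao's Theorem 1.5 in local form — TRUE in
print (the tree proves the global-nonexistence face `Tao2016.averagedNS_blowup_holds`; passing to a
maximal solution needs the local `H¹⁰` theory), and the printed witness is Type II. Recorded to make
explicit that the rate conjunct carries the entire content of the crux. [cite: Tao2016AveragedNS, Thm. 1.5] -/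
def AveragedBlowupNoRate : Prop :=
  ∃ 𝒜 : AveragingDatum, 𝒜.IsSymmetric ∧ 𝒜.HasCancellation ∧
    ∃ u₀ : SchwartzMap ℝ³ ℝ³, VectorCalculus.IsDivFree ⇑u₀ ∧ ∃ T : ℝ, 0 < T ∧ ∃ u : ℝ → L2C,
      𝒜.IsMildSolution (schwartzL2 u₀) (Ico 0 T) u ∧
      ¬ ∃ T' : ℝ, T < T' ∧ ∃ v : ℝ → L2C,
        𝒜.IsMildSolution (schwartzL2 u₀) (Ico 0 T') v ∧ ∀ t ∈ Ico 0 T, v t = u t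

/-- The crux implies its rate-free weakening (trivial bookkeeping). [folklore] -/
theorem averagedBlowupNoRate_of_crux (h : AveragedTypeIBlowup) : AveragedBlowupNoRate := by
  obtain ⟨𝒜, hs, hc, u₀, hdiv, T, hT, u, hmild, -, hno⟩ := h
  exact ⟨𝒜, hs, hc, u₀, hdiv, T, hT, u, hmild, hno⟩

/-- The crux STRENGTHENED to a subcritical rate `‖u(t)‖_∞ ≤ M (T-t)^{-β}`, `β < 1/2`. Expected
FALSE for every averaging datum (Serrin-class continuation via `L^p` multiplier bounds, `p < ∞`;
module docstring item 5) — a proof would be the first abstract continuation criterion formalised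
for the class; NOT claimed here. [cite: Tao2016AveragedNS, §1.1 p. 7 footnote] -/
def AveragedSubcriticalBlowup : Prop :=
  ∃ 𝒜 : AveragingDatum, 𝒜.IsSymmetric ∧ 𝒜.HasCancellation ∧
    ∃ u₀ : SchwartzMap ℝ³ ℝ³, VectorCalculus.IsDivFree ⇑u₀ ∧ ∃ T : ℝ, 0 < T ∧ ∃ u : ℝ → L2C,
      𝒜.IsMildSolution (schwartzL2 u₀) (Ico 0 T) u ∧
      (∃ β : ℝ, β < 1 / 2 ∧ ∃ M : ℝ, ∀ t ∈ Ico 0 T,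
        eLpNorm (u t) ⊤ volume ≤ ENNReal.ofReal (M / (T - t) ^ β)) ∧
      ¬ ∃ T' : ℝ, T < T' ∧ ∃ v : ℝ → L2C,
        𝒜.IsMildSolution (schwartzL2 u₀) (Ico 0 T') v ∧ ∀ t ∈ Ico 0 T, v t = u t

/-- Elementary rate comparison: on `[0,T)`, `M (T-t)^{-β} ≤ M T^{1/2-β} (T-t)^{-1/2}` for
`β < 1/2`, `M ≥ 0`. [folklore] -/
theorem subcritical_rate_le {T t β M : ℝ} (ht : t ∈ Ico 0 T) (hβ : β < 1 / 2) (hM : 0 ≤ M) :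
    M / (T - t) ^ β ≤ M * T ^ (1 / 2 - β) / Real.sqrt (T - t) := by
  have hs : 0 < T - t := sub_pos.mpr ht.2
  have hsT : T - t ≤ T := sub_le_self T ht.1
  have hexp : 0 ≤ 1 / 2 - β := by linarith
  have h1 : M / (T - t) ^ β = M * (T - t) ^ (1 / 2 - β) / Real.sqrt (T - t) := by
    rw [Real.sqrt_eq_rpow, mul_div_assoc, ← Real.rpow_sub hs, show (1 / 2 - β) - 1 / 2 = -β by ring,
      Real.rpow_neg hs.le, div_eq_mul_inv]
  rw [h1]
  have hsqrt : 0 < Real.sqrt (T - t) := Real.sqrt_pos.mpr hs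
  have hpow : (T - t) ^ (1 / 2 - β) ≤ T ^ (1 / 2 - β) := Real.rpow_le_rpow hs.le hsT hexp
  gcongr

/-- **A subcritical-rate blow-up would in particular be a Type-I blow-up**: the tier
`AveragedSubcriticalBlowup` implies the crux (no Sobolev embedding needed: the rate hypothesis
holds on all of `[0,T)`). Contrapositively, a disproof of the crux also excludes every rate
`(T-t)^{-β}`, `β < 1/2` — the tier expected to be abstractly excludable anyway (Serrin class via
`L^p`, `p < ∞`, multiplier bounds; work-file docstring item 5). [folklore] -/
theorem averagedTypeIBlowup_of_subcritical (h : AveragedSubcriticalBlowup) : AveragedTypeIBlowup := by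
  obtain ⟨𝒜, hs, hc, u₀, hdiv, T, hT, u, hmild, ⟨β, hβ, M, hM⟩, hno⟩ := h
  refine ⟨𝒜, hs, hc, u₀, hdiv, T, hT, u, hmild, ⟨max M 0 * T ^ (1 / 2 - β), fun t ht => ?_⟩, hno⟩
  refine (hM t ht).trans (ENNReal.ofReal_le_ofReal ?_)
  have hs' : 0 < T - t := sub_pos.mpr ht.2
  calc M / (T - t) ^ β ≤ max M 0 / (T - t) ^ β :=
        div_le_div_of_nonneg_right (le_max_left M 0) (Real.rpow_nonneg hs'.le β)
    _ ≤ max M 0 * T ^ (1 / 2 - β) / Real.sqrt (T - t) :=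
        subcritical_rate_le ht hβ (le_max_right M 0)

/-- The negative reading: `¬ crux` excludes the whole subcritical tier as well. [folklore] -/
theorem not_subcritical_of_not_averagedTypeIBlowup (h : ¬ AveragedTypeIBlowup) :
    ¬ AveragedSubcriticalBlowup := fun h' => h (averagedTypeIBlowup_of_subcritical h')

/-! ## 8. Scalar multiples of averaging data; the Type-I constant can be normalised -/

/-- A real scalar multiple of a real order-`0` symbol is a real order-`0` symbol. [folklore] -/
theorem isRealSymbol_const_mul {m : ℝ³ → ℂ} (hm : IsRealSymbol m) (c : ℝ) :
    IsRealSymbol (fun ξ => (c : ℂ) * m ξ) := by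
  refine ⟨contDiffOn_const.mul hm.1, fun k => lt_of_le_of_lt
    (symbolSeminorm_const_mul_le hm.1 (c : ℂ) k) (ENNReal.mul_lt_top enorm_lt_top (hm.2.1 k)),
    fun ξ hξ => ?_⟩
  simp only [hm.2.2 ξ hξ, map_mul, Complex.conj_ofReal]

/-- **The real scalar multiple `c • 𝒜` of an averaging datum**: the slot-`0` symbol multiplied by
the real constant `c` (Tao 2016, §3.2 ¶1: "using `m_{1,ω}(D)` to absorb scalar factors"); its form
is `c` times the form of `𝒜` (`rscale_form`). The class of averaging data is a CONE.
[cite: Tao2016AveragedNS, §3.2 p. 15] -/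
def rscale (𝒜 : AveragingDatum) (c : ℝ) : AveragingDatum where
  Ω := 𝒜.Ω
  μ := 𝒜.μ
  m i θ := if i = 0 then fun ξ => (c : ℂ) * 𝒜.m 0 θ ξ else 𝒜.m i θ
  R := 𝒜.R
  lam := 𝒜.lam
  isRealSymbol i θ := by
    by_cases hi : i = 0
    · subst hi
      simpa using isRealSymbol_const_mul (𝒜.isRealSymbol 0 θ) c
    · simpa [hi] using 𝒜.isRealSymbol i θ
  det_R := 𝒜.det_R
  lam_pos := 𝒜.lam_pos
  lam_bdd := 𝒜.lam_bdd
  moment k₁ k₂ k₃ := by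
    simp only [if_true, show (1 : Fin 3) ≠ 0 by decide, show (2 : Fin 3) ≠ 0 by decide, if_false]
    calc ∫⁻ θ, symbolSeminorm k₁ (fun ξ => (c : ℂ) * 𝒜.m 0 θ ξ) * symbolSeminorm k₂ (𝒜.m 1 θ) *
          symbolSeminorm k₃ (𝒜.m 2 θ) ∂𝒜.μ
        ≤ ∫⁻ θ, ‖(c : ℂ)‖ₑ * (symbolSeminorm k₁ (𝒜.m 0 θ) * symbolSeminorm k₂ (𝒜.m 1 θ) *
          symbolSeminorm k₃ (𝒜.m 2 θ)) ∂𝒜.μ := by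
          refine lintegral_mono fun θ => ?_
          rw [← mul_assoc, ← mul_assoc]
          gcongr
          exact symbolSeminorm_const_mul_le (𝒜.isRealSymbol 0 θ).1 (c : ℂ) k₁
      _ < ∞ := by
          rw [lintegral_const_mul' _ _ enorm_ne_top]
          exact ENNReal.mul_lt_top enorm_lt_top (𝒜.moment k₁ k₂ k₃)
  measurable_m i ξ hξ := by
    by_cases hi : i = 0
    · subst hi
      simpa using (𝒜.measurable_m 0 ξ hξ).const_mul (c : ℂ)
    · simpa [hi] using 𝒜.measurable_m i ξ hξ
  measurable_R := 𝒜.measurable_R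
  measurable_lam := 𝒜.measurable_lam

/-- The `L^∞` class of the scaled symbol. [folklore] -/
theorem rscale_symbolLp_zero (𝒜 : AveragingDatum) (c : ℝ) (θ : 𝒜.Ω) :
    (rscale 𝒜 c).symbolLp 0 θ = (c : ℂ) • 𝒜.symbolLp 0 θ := by
  unfold AveragingDatum.symbolLp
  rw [← MemLp.toLp_const_smul]
  rfl

/-- Slot `0` of the scaled datum is `c` times slot `0`. [folklore] -/
theorem rscale_slot_zero (𝒜 : AveragingDatum) (c : ℝ) (θ : 𝒜.Ω) (u : L2C) :
    (rscale 𝒜 c).slot 0 θ u = (c : ℂ) • 𝒜.slot 0 θ u := by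
  unfold AveragingDatum.slot
  rw [rscale_symbolLp_zero, fourierMultiplier_symbol_smul]
  rfl

/-- Slots `1, 2` of the scaled datum are unchanged. [folklore] -/
theorem rscale_slot_of_ne_zero (𝒜 : AveragingDatum) (c : ℝ) {i : Fin 3} (hi : i ≠ 0) (θ : 𝒜.Ω)
    (u : L2C) : (rscale 𝒜 c).slot i θ u = 𝒜.slot i θ u := by
  unfold AveragingDatum.slot AveragingDatum.symbolLp
  have h : (rscale 𝒜 c).m i θ = 𝒜.m i θ := by simp [rscale, hi]
  congr 1
  exact MemLp.toLp_congr _ _ (Eventually.of_forall fun ξ => by rw [h])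

/-- **The form of `c • 𝒜` is `c` times the form of `𝒜`** (unconditionally: Bochner integrals are
homogeneous even on non-integrable integrands). [folklore] -/
theorem rscale_form (𝒜 : AveragingDatum) (c : ℝ) (u v w : L2C) :
    (rscale 𝒜 c).form u v w = (c : ℂ) * 𝒜.form u v w := by
  unfold AveragingDatum.form
  rw [← integral_const_mul]
  refine integral_congr_ae (Eventually.of_forall fun θ => ?_)
  change eulerForm ((rscale 𝒜 c).slot 0 θ u) ((rscale 𝒜 c).slot 1 θ v) ((rscale 𝒜 c).slot 2 θ w) =
    (c : ℂ) * eulerForm (𝒜.slot 0 θ u) (𝒜.slot 1 θ v) (𝒜.slot 2 θ w)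
  rw [rscale_slot_zero, rscale_slot_of_ne_zero 𝒜 c (show (1 : Fin 3) ≠ 0 by decide),
    rscale_slot_of_ne_zero 𝒜 c (show (2 : Fin 3) ≠ 0 by decide), eulerForm_smul₁]

/-- Scaling preserves symmetry. [folklore] -/
theorem rscale_isSymmetric {𝒜 : AveragingDatum} (h : 𝒜.IsSymmetric) (c : ℝ) :
    (rscale 𝒜 c).IsSymmetric := fun u v w hu hv hw => by
  rw [rscale_form, rscale_form, h u v w hu hv hw]

/-- Scaling preserves the cancellation property (1.16). [folklore] -/
theorem rscale_hasCancellation {𝒜 : AveragingDatum} (h : 𝒜.HasCancellation) (c : ℝ) :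
    (rscale 𝒜 c).HasCancellation := fun u hu => by
  rw [rscale_form, h u hu, mul_zero]

/-! ### Linearity bookkeeping -/

/-- The slot operators `Aᵢ(θ) = mᵢ(D) Rot Dil` are homogeneous. [folklore] -/
theorem slot_smul (𝒜 : AveragingDatum) (i : Fin 3) (θ : 𝒜.Ω) (a : ℂ) (u : L2C) :
    𝒜.slot i θ (a • u) = a • 𝒜.slot i θ u := by
  unfold AveragingDatum.slot
  rw [dil_smul, rot_smul, fourierMultiplier_smul]

/-- Homogeneity of the Euler form in its second slot. [folklore] -/
theorem eulerForm_smul₂ (c : ℂ) (x y z : L2C) : eulerForm x (c • y) z = c * eulerForm x y z := by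
  rw [eulerForm_symm, eulerForm_smul₁, eulerForm_symm]

/-- The quadratic form scales quadratically: `⟨B̃(au, au), w⟩ = a² ⟨B̃(u,u), w⟩`. [folklore] -/
theorem form_smul_smul (𝒜 : AveragingDatum) (a : ℂ) (u w : L2C) :
    𝒜.form (a • u) (a • u) w = a ^ 2 * 𝒜.form u u w := by
  unfold AveragingDatum.form
  rw [← integral_const_mul]
  refine integral_congr_ae (Eventually.of_forall fun θ => ?_)
  change eulerForm (𝒜.slot 0 θ (a • u)) (𝒜.slot 1 θ (a • u)) (𝒜.slot 2 θ w) =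
    a ^ 2 * eulerForm (𝒜.slot 0 θ u) (𝒜.slot 1 θ u) (𝒜.slot 2 θ w)
  rw [slot_smul, slot_smul, eulerForm_smul₁, eulerForm_smul₂]
  ring

/-- The heat propagator is homogeneous. [folklore] -/
theorem heat_smul (τ : ℝ) (a : ℂ) (u : L2C) : heat τ (a • u) = a • heat τ u := by
  unfold heat
  rw [fourierMultiplier_smul]

/-- `‖a u‖_{H^s} = |a| ‖u‖_{H^s}`. [folklore] -/
theorem eFourierSobolevNorm_smul (s : ℝ) (a : ℂ) (u : L2C) :
    Literature.Analysis.FunctionSpaces.eFourierSobolevNorm s (a • u) =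
      ‖a‖ₑ * Literature.Analysis.FunctionSpaces.eFourierSobolevNorm s u := by
  rw [eFourierSobolevNorm_eq, eFourierSobolevNorm_eq,
    sobolevWeightIntegral_congr_ae (fourierFn_smul a u), sobolevWeightIntegral_smul,
    ENNReal.mul_rpow_of_nonneg _ _ (by norm_num : (0 : ℝ) ≤ 1 / 2)]
  congr 1
  rw [← ENNReal.rpow_natCast, ← ENNReal.rpow_mul]
  norm_num

/-- `H¹⁰`-continuity is preserved by scalars. [folklore] -/
theorem continuousInH10On_smul {I : Set ℝ} {u : ℝ → L2C} (h : ContinuousInH10On I u) (a : ℂ) :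
    ContinuousInH10On I (fun t => a • u t) := by
  intro t₀ ht₀
  have h' := h t₀ ht₀
  simp_rw [← smul_sub, eFourierSobolevNorm_smul]
  have := ENNReal.Tendsto.const_mul h' (Or.inr enorm_ne_top : (0 : ℝ≥0∞) ≠ 0 ∨ ‖a‖ₑ ≠ ∞)
  rwa [mul_zero] at this

/-- `H¹⁰_df` membership is invariant under non-zero real scalars. [folklore] -/
theorem memH10df_smul_iff {c : ℝ} (hc : c ≠ 0) (u : L2C) : MemH10df ((c : ℂ) • u) ↔ MemH10df u := by
  refine ⟨fun h => ?_, fun h => h.smul c⟩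
  have h' := h.smul c⁻¹
  rwa [smul_smul, ← Complex.ofReal_mul, inv_mul_cancel₀ hc, Complex.ofReal_one, one_smul] at h'

/-- `H¹⁰`-continuity is invariant under non-zero scalars. [folklore] -/
theorem continuousInH10On_smul_iff {a : ℂ} (ha : a ≠ 0) (I : Set ℝ) (u : ℝ → L2C) :
    ContinuousInH10On I (fun t => a • u t) ↔ ContinuousInH10On I u := by
  refine ⟨fun h => ?_, fun h => continuousInH10On_smul h a⟩
  have h' := continuousInH10On_smul h a⁻¹
  simp_rw [smul_smul, inv_mul_cancel₀ ha, one_smul] at h'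
  exact h'

/-- **Mild solutions scale**: `u` is a mild solution of `∂ₜu = Δu + B̃(u,u)` with datum `u₀` iff
`c u` is a mild solution of `∂ₜv = Δv + c⁻¹ B̃(v,v)` with datum `c u₀` (`c ≠ 0` real). [folklore] -/
theorem isMildSolution_rscale_smul_iff {c : ℝ} (hc : c ≠ 0) (𝒜 : AveragingDatum) (u₀ : L2C)
    (I : Set ℝ) (u : ℝ → L2C) :
    (rscale 𝒜 c⁻¹).IsMildSolution ((c : ℂ) • u₀) I (fun t => (c : ℂ) • u t) ↔
      𝒜.IsMildSolution u₀ I u := by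
  have hc' : (c : ℂ) ≠ 0 := Complex.ofReal_ne_zero.mpr hc
  unfold AveragingDatum.IsMildSolution IsMildSolutionFor
  have h1 : (∀ t ∈ I, MemH10df ((c : ℂ) • u t)) ↔ ∀ t ∈ I, MemH10df (u t) := by
    simp_rw [memH10df_smul_iff hc]
  have h3 : ∀ t w, (pairing ((c : ℂ) • u t) w = pairing (heat t ((c : ℂ) • u₀)) w +
      ∫ s in (0 : ℝ)..t, (rscale 𝒜 c⁻¹).form ((c : ℂ) • u s) ((c : ℂ) • u s) (heat (t - s) w)) ↔
      (pairing (u t) w = pairing (heat t u₀) w + ∫ s in (0 : ℝ)..t, 𝒜.form (u s) (u s) (heat (t - s) w)) := by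
    intro t w
    simp_rw [rscale_form, form_smul_smul, heat_smul, pairing_smul_left]
    have hcoef : ∀ z : ℂ, ((c⁻¹ : ℝ) : ℂ) * ((c : ℂ) ^ 2 * z) = (c : ℂ) * z := fun z => by
      rw [Complex.ofReal_inv]
      field_simp
    simp_rw [hcoef, intervalIntegral.integral_const_mul, ← mul_add]
    exact mul_right_inj' hc'
  rw [h1, continuousInH10On_smul_iff hc']
  constructor
  · rintro ⟨hA, hB, hC⟩
    exact ⟨hA, hB, fun t ht w hw => (h3 t w).mp (hC t ht w hw)⟩
  · rintro ⟨hA, hB, hC⟩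
    exact ⟨hA, hB, fun t ht w hw => (h3 t w).mpr (hC t ht w hw)⟩

/-! ### The crux with a prescribed Type-I constant -/

/-- Type-I blow-up for the datum `𝒜` with the Type-I constant FIXED to `M`. [folklore] -/
def TypeIBlowupWith (𝒜 : AveragingDatum) (M : ℝ) : Prop :=
  ∃ u₀ : SchwartzMap ℝ³ ℝ³, VectorCalculus.IsDivFree ⇑u₀ ∧ ∃ T : ℝ, 0 < T ∧ ∃ u : ℝ → L2C,
    𝒜.IsMildSolution (schwartzL2 u₀) (Ico 0 T) u ∧
    (∀ t ∈ Ico 0 T, eLpNorm (u t) ⊤ volume ≤ ENNReal.ofReal (M / Real.sqrt (T - t))) ∧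
    ¬ ∃ T' : ℝ, T < T' ∧ ∃ v : ℝ → L2C,
      𝒜.IsMildSolution (schwartzL2 u₀) (Ico 0 T') v ∧ ∀ t ∈ Ico 0 T, v t = u t

/-- The crux with the Type-I constant FIXED to `M`: `∃ 𝒜` symmetric with cancellation having a
Type-I blow-up with constant `M`. [folklore] -/
def AveragedTypeIBlowupWithRate (M : ℝ) : Prop :=
  ∃ 𝒜 : AveragingDatum, 𝒜.IsSymmetric ∧ 𝒜.HasCancellation ∧ TypeIBlowupWith 𝒜 M

/-- The crux is the union over `M` of its fixed-constant versions. [folklore] -/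
theorem averagedTypeIBlowup_iff_exists_rate :
    AveragedTypeIBlowup ↔ ∃ M : ℝ, AveragedTypeIBlowupWithRate M := by
  constructor
  · rintro ⟨𝒜, hs, hc, u₀, hdiv, T, hT, u, hmild, ⟨M, hM⟩, hno⟩
    exact ⟨M, 𝒜, hs, hc, u₀, hdiv, T, hT, u, hmild, hM, hno⟩
  · rintro ⟨M, 𝒜, hs, hc, u₀, hdiv, T, hT, u, hmild, hM, hno⟩
    exact ⟨𝒜, hs, hc, u₀, hdiv, T, hT, u, hmild, ⟨M, hM⟩, hno⟩

/-- The `L^∞` norm of a scaled `L²` class. [folklore] -/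
theorem eLpNorm_top_smul (a : ℂ) (f : L2C) :
    eLpNorm ((a • f : L2C) : ℝ³ → EuclideanSpace ℂ (Fin 3)) ⊤ volume = ‖a‖ₑ * eLpNorm f ⊤ volume := by
  rw [eLpNorm_congr_ae (Lp.coeFn_smul a f), eLpNorm_const_smul]

/-- **Amplitude–coupling duality**: a Type-I blow-up with constant `M` for `𝒜` yields one with
constant `c M` for the datum `c⁻¹ • 𝒜`, for every `c > 0` (take `v = c u`, datum `c u₀`). [folklore] -/
theorem typeIBlowupWith_rscale {𝒜 : AveragingDatum} {M c : ℝ} (hc : 0 < c)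
    (h : TypeIBlowupWith 𝒜 M) : TypeIBlowupWith (rscale 𝒜 c⁻¹) (c * M) := by
  obtain ⟨u₀, hdiv, T, hT, u, hmild, hrate, hno⟩ := h
  have hc0 : c ≠ 0 := hc.ne'
  have hc' : (c : ℂ) ≠ 0 := Complex.ofReal_ne_zero.mpr hc0
  refine ⟨c • u₀, ?_, T, hT, fun t => (c : ℂ) • u t, ?_, ?_, ?_⟩
  · -- divergence free
    have : (⇑(c • u₀) : ℝ³ → ℝ³) = fun y => c • u₀ y := rfl
    rw [this]
    exact VectorCalculus.IsDivFree.const_smul u₀.differentiable hdiv c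
  · rw [schwartzL2_smul]
    exact (isMildSolution_rscale_smul_iff hc0 𝒜 _ _ _).mpr hmild
  · intro t ht
    rw [eLpNorm_top_smul]
    calc ‖(c : ℂ)‖ₑ * eLpNorm (u t) ⊤ volume
        ≤ ENNReal.ofReal c * ENNReal.ofReal (M / Real.sqrt (T - t)) := by
          gcongr
          · rw [← ofReal_norm, Complex.norm_real, Real.norm_eq_abs, abs_of_pos hc]
          · exact hrate t ht
      _ = ENNReal.ofReal (c * M / Real.sqrt (T - t)) := by
          rw [← ENNReal.ofReal_mul hc.le, mul_div_assoc]
  · rintro ⟨T', hTT', v', hv', hagree⟩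
    apply hno
    refine ⟨T', hTT', fun t => ((c : ℂ))⁻¹ • v' t, ?_, fun t ht => ?_⟩
    · have hfun : (fun t => (c : ℂ) • (((c : ℂ))⁻¹ • v' t)) = v' := by
        funext t
        rw [smul_smul, mul_inv_cancel₀ hc', one_smul]
      rw [schwartzL2_smul] at hv'
      rw [← isMildSolution_rscale_smul_iff hc0 𝒜, hfun]
      exact hv'
    · change ((c : ℂ))⁻¹ • v' t = u t
      rw [hagree t ht, smul_smul, inv_mul_cancel₀ hc', one_smul]

/-- **The Type-I constant is not an invariant of the class.** For every `ε > 0`: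
`AveragedTypeIBlowup ↔ AveragedTypeIBlowupWithRate ε` — the crux is equivalent to its apparent
strengthening "Type-I blow-up with constant `ε`", because the class of symmetric averaging data with
cancellation is a cone (`rscale`) and `u ↦ c u` trades amplitude for coupling. Contrast: for the
Navier–Stokes datum itself the constant is bounded below (Leray 1934: a blow-up at `T` forces
`‖u(t)‖_∞ ≥ c₀ √(ν/(T-t))`), by the `L^∞` local theory — which is NOT available for general
order-`0` multipliers (unbounded on `L^∞`; Tao 2016 p. 7 footnote). So "small-constant Type I" is one
more NS-false / class-open tier, and no class-wide disproof can exploit the size of `M`.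
[cite: Tao2016AveragedNS, §1.1 p. 7 footnote; §3.2 p. 15] -/
theorem averagedTypeIBlowup_iff_withRate {ε : ℝ} (hε : 0 < ε) :
    AveragedTypeIBlowup ↔ AveragedTypeIBlowupWithRate ε := by
  constructor
  · rintro ⟨𝒜, hs, hcanc, u₀, hdiv, T, hT, u, hmild, ⟨M, hM⟩, hno⟩
    by_cases hMε : M ≤ ε
    · -- the same witness works
      refine ⟨𝒜, hs, hcanc, u₀, hdiv, T, hT, u, hmild, fun t ht => (hM t ht).trans ?_, hno⟩
      exact ENNReal.ofReal_le_ofReal (div_le_div_of_nonneg_right hMε (Real.sqrt_nonneg _))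
    · -- rescale by c = ε / M
      have hMpos : 0 < M := hε.trans (lt_of_not_ge hMε)
      have hc : 0 < ε / M := div_pos hε hMpos
      have h := typeIBlowupWith_rscale hc (⟨u₀, hdiv, T, hT, u, hmild, hM, hno⟩ : TypeIBlowupWith 𝒜 M)
      rw [div_mul_cancel₀ ε hMpos.ne'] at h
      exact ⟨rscale 𝒜 (ε / M)⁻¹, rscale_isSymmetric hs _, rscale_hasCancellation hcanc _, h⟩
  · rintro ⟨𝒜, hs, hc, u₀, hdiv, T, hT, u, hmild, hM, hno⟩
    exact ⟨𝒜, hs, hc, u₀, hdiv, T, hT, u, hmild, ⟨ε, hM⟩, hno⟩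

/-- In particular the crux is equivalent to its unit-constant version. [folklore] -/
theorem averagedTypeIBlowup_iff_unitRate : AveragedTypeIBlowup ↔ AveragedTypeIBlowupWithRate 1 :=
  averagedTypeIBlowup_iff_withRate one_pos



/-! ## 11. Uniform-damping conjugacy (ideator note N1), kernel-checked -/

/-- The effective (inviscid) time of the uniformly damped flow: `τ(t) = (1 - e^{-Dt})/D`. [folklore] -/
def effTime (D t : ℝ) : ℝ := (1 - Real.exp (-(D * t))) / D

/-- `d/ds (-(D s)) = -D`. [folklore] -/
theorem hasDerivAt_neg_mul (D t : ℝ) : HasDerivAt (fun s : ℝ => -(D * s)) (-D) t := by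
  have h := ((hasDerivAt_id t).const_mul D).neg
  simp only [id_eq, mul_one] at h
  exact h

/-- `d/ds e^{-Ds} = -D e^{-Ds}`. [folklore] -/
theorem hasDerivAt_exp_neg_mul (D t : ℝ) :
    HasDerivAt (fun s : ℝ => Real.exp (-(D * s))) (Real.exp (-(D * t)) * -D) t :=
  (Real.hasDerivAt_exp _).comp t (hasDerivAt_neg_mul D t)

/-- `τ'(t) = e^{-Dt}`. [folklore] -/
theorem hasDerivAt_effTime {D : ℝ} (hD : D ≠ 0) (t : ℝ) :
    HasDerivAt (effTime D) (Real.exp (-(D * t))) t := by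
  unfold effTime
  have h3 : HasDerivAt (fun s : ℝ => (1 - Real.exp (-(D * s))) / D)
      ((0 - Real.exp (-(D * t)) * -D) / D) t :=
    ((hasDerivAt_const t (1 : ℝ)).sub (hasDerivAt_exp_neg_mul D t)).div_const D
  convert h3 using 1
  field_simp
  ring

/-- For `t ≥ 0` and `D > 0` the effective time lies in `[0, 1/D)`. [folklore] -/
theorem effTime_mem_Ico {D : ℝ} (hD : 0 < D) {t : ℝ} (ht : 0 ≤ t) : effTime D t ∈ Ico 0 (1 / D) := by
  unfold effTime
  have hexp : 0 < Real.exp (-(D * t)) := Real.exp_pos _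
  have hle : Real.exp (-(D * t)) ≤ 1 := Real.exp_le_one_iff.mpr (by nlinarith)
  constructor
  · exact div_nonneg (by linarith) hD.le
  · exact div_lt_div_of_pos_right (by linarith) hD

/-- **Uniform-damping conjugacy (N1 of the ideator notes, kernel-checked).** Let `G` be a
continuous bilinear map on a real normed space and `D > 0`. If `Y` solves the INVISCID quadratic
system `Y' = G(Y,Y)` on the effective-time window `[0, 1/D)`, then
`X(t) := e^{-Dt} Y(τ(t))`, `τ(t) = (1 - e^{-Dt})/D`, solves the UNIFORMLY DAMPED system
`X' = -D X + G(X,X)` for all `t ≥ 0`. Consequences (with ODE uniqueness, not formalised here): the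
damped flow with datum `X(0) = Y(0)` is the inviscid flow run for the finite effective time
`τ < 1/D` with amplitudes multiplied by `e^{-Dt} = 1 - Dτ`; an inviscid event at time `τ_c`
(ignition, completion of a transfer) happens in the damped system iff `τ_c < 1/D` ("fire or die"),
and every energy FRACTION delivered by a single uniformly damped gate is independent of the
amplitude at first order — which is why amplitude-blind chains have a REPELLING Type-I fixed point
and why "attracting Type-I" designs must read an inter-scale damping contrast. [folklore] -/
theorem hasDerivAt_uniformDamping_conj {E : Type*} [NormedAddCommGroup E] [NormedSpace ℝ E]
    (G : E →L[ℝ] E →L[ℝ] E) {D : ℝ} (hD : 0 < D) {Y : ℝ → E}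
    (hY : ∀ τ ∈ Ico 0 (1 / D), HasDerivAt Y (G (Y τ) (Y τ)) τ) {t : ℝ} (ht : 0 ≤ t) :
    HasDerivAt (fun s => Real.exp (-(D * s)) • Y (effTime D s))
      (-(D • (Real.exp (-(D * t)) • Y (effTime D t))) +
        G (Real.exp (-(D * t)) • Y (effTime D t)) (Real.exp (-(D * t)) • Y (effTime D t))) t := by
  have hτ := hasDerivAt_effTime hD.ne' t
  have hYτ : HasDerivAt Y (G (Y (effTime D t)) (Y (effTime D t))) (effTime D t) :=
    hY _ (effTime_mem_Ico hD ht)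
  have hcomp : HasDerivAt (fun s => Y (effTime D s))
      (Real.exp (-(D * t)) • G (Y (effTime D t)) (Y (effTime D t))) t :=
    hYτ.scomp t hτ
  have key : HasDerivAt (fun s => Real.exp (-(D * s)) • Y (effTime D s))
      (Real.exp (-(D * t)) • (Real.exp (-(D * t)) • G (Y (effTime D t)) (Y (effTime D t))) +
        (Real.exp (-(D * t)) * -D) • Y (effTime D t)) t :=
    (hasDerivAt_exp_neg_mul D t).smul hcomp
  refine key.congr_deriv ?_
  have hG : G (Real.exp (-(D * t)) • Y (effTime D t)) (Real.exp (-(D * t)) • Y (effTime D t)) =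
      Real.exp (-(D * t)) • (Real.exp (-(D * t)) • G (Y (effTime D t)) (Y (effTime D t))) := by
    rw [G.map_smul]
    change Real.exp (-(D * t)) • G (Y (effTime D t)) (Real.exp (-(D * t)) • Y (effTime D t)) = _
    rw [(G (Y (effTime D t))).map_smul]
  rw [hG, mul_neg, neg_smul, mul_comm (Real.exp (-(D * t))) D, ← smul_smul]
  abel


end Summit.NavierStokesRegularity.NavierStokesRegularity.Cruxes.AveragedTypeIBlowup.Disproof

end
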